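import Summits.BirchSwinnertonDyer.BirchSwinnertonDyer.Theorems.EisensteinPrimesGoodLatticeResidualPairScalarsAtMultiplicative
import Literature.NumberTheory.EllipticCurves.KellerYin2024.AnticyclotomicLocalEulerFactors
import Literature.NumberTheory.GaloisRepresentations.GaloisRepFrobeniusProofs
import Literature.NumberTheory.EllipticCurves.ArtinFormalismSemistableLocalProofs
import Literature.NumberTheory.EllipticCurves.HasseWeilAbelianBadReduction
import Literature.NumberTheory.GaloisRepresentations.HeckeCharacterProofs
import Summits.BirchSwinnertonDyer.BirchSwinnertonDyer.Theorems.EisensteinPrimesUnrSelmerQuotientTorsionFiniteChar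
import HarnessLib

/-!
# (eq:Euler-comp) at a MULTIPLICATIVE place, in closed form: for the good lattice,
# `λ(𝒫_w(θsub)) + λ(𝒫_w(θquot)) = λ(𝒫_w(f_E)) + [Γ : Γ_w]·[E split multiplicative at ℓ]`

Cell `bsd-eis`, width seat `bsd-line-x1-p1-w2` gen 23, crux 2 `GoodLatticeBDPValue` (stmt-BirchSwinnertonDyer-19032), line
`halves` v33N; helper `--supports`, closes no stub. PROVED, no named fact, no `sorry`.

WHY. Castella–Grossi–Lee–Skinner, proof of Thm. 2.2.2 (held text paper:arxiv-2008.02571 p. 12 L104–121): with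
`{φ(ℓ), ψ(ℓ)} = {a_ℓ ℓ, a_ℓ}` at `ℓ ∥ N` (Tate curve) the congruences `a_ℓ ≡ φ(ℓ)` / `a_ℓ ≡ ψ(ℓ)` of Thm. 2.2.1 rewrite
`λ(𝓔_{φ,ψ})` as (eq:Euler-comp) `Σ_{w∈S} {λ(𝒫_w(φ)) + λ(𝒫_w(ψ)) − λ(𝒫_w(E))}`.  In the tree's closed-form currency
(`KellerYin2024/AnticyclotomicLocalEulerFactors`: `charLocalLambda = [Γ:Γ_w]·𝟙[θ unramified at w ∧ θ(Frob_w) ≡ Nw]`,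
`curveLocalLambda = [Γ:Γ_w]·mult_{(Nw)⁻¹} P̃_w`) the summand at a multiplicative place is a CLOSED-FORM number,
INDEPENDENT of which of `θsub, θquot` is the Tate line:
`charLocalLambda θsub w + charLocalLambda θquot w = curveLocalLambda (E/K) w + [Γ : Γ_w]·[E split at ℓ]`
(`[ℓa_ℓ ≡ ℓ] + [a_ℓ ≡ ℓ] = [a_ℓ ≡ 1] + [a_ℓ ≡ ℓ]`).  This file proves it at the binders of the CONTENT stub 3a-A,
from this seat's `…GoodLatticeResidualPairScalarsAtMultiplicative` (the scalars `{a_ℓ ℓ, a_ℓ}` at a `K`-Frobenius),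
`…ResidualPairUnramifiedAtMultiplicative` (unramifiedness), the tree's `IsUnramifiedAt.hasFrobCharpolyAt_charpoly`
(Frobenius characteristic polynomial of an unramified representation) and the base change of the local polynomial at a
multiplicative place (`localPolynomialAt_baseChange_of_hasMultiplicativeReductionAt`, Silverman VII.5.4 (b)).

* §1 `charpoly_eq_X_sub_C_entry`, `hasFrobCharpolyAt_entry`, **`frobActsAsNormAt_iff_intCast_eq`** — for a rank-one `θ`
  unramified at `w`, a Frobenius `σ₀` above `w` and an integer `a ≡ θ(σ₀)`: `FrobActsAsNormAt S θ w ↔ (a ≡ Nw mod p)`.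
* §2 **`curveLocalLambda_baseChange_of_hasMultiplicativeReductionAt`** — `E/ℚ`, `w ∋ ℓ` with `f(w|ℓ) = 1`,
  `L_ℓ(E) = 1 − εT`: `curveLocalLambda κ (E_K) w = [Γ:Γ_w]·[ε ≡ ℓ (mod p)]`.
* §3 **`eulerComp_summand_of_hasMultiplicativeReductionAtPrime`** — the displayed identity (non-split `ℓ` odd, as in
  x2-p1-w7's engine); `…_of_heegner` — the same with `f(w|ℓ) = 1` supplied by the Heegner hypothesis for `N_E`.

HONEST FRAMING: helper lemmas on the tree's own objects; 0 stubs / cells / labels / tiers move; orphan for -19032 until a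
CGLS-2.2.1-shaped typing of 3a-A consumes it; no summit statement, no case of BSD, no crux or stub is proved here.
References: [CastellaGrossiLeeSkinner2022] Thm. 2.2.1 / proof of Thm. 2.2.2 (eq:Euler-comp); [GreenbergVatsal2000] §2 Prop.
(2.4), pp. 14–15; [KellerYin2024] Lemma 1.1.1, §1.5; [SerreAbelianLadic1968] Ch. I §2.1; [SilvermanAEC2009] VII.5.4, §C.16.
-/

set_option autoImplicit false
set_option linter.dupNamespace false

noncomputable section

open scoped Classical

open NumberField IsDedekindDomain Field WeierstrassCurve Polynomial
  Literature.NumberTheory.EllipticCurves Literature.NumberTheory.GaloisRepresentations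
  Literature.NumberTheory.EllipticCurves.Rank1Residual
  Literature.NumberTheory.EllipticCurves.KellerYin2024

namespace Summit.BirchSwinnertonDyer.BirchSwinnertonDyer.Theorems.GoodLatticeAnacongEulerCompMultiplicative

variable {p : ℕ} [hp : Fact p.Prime] {S : Set (PadicAlgCl p)}

/-! ## §1 `FrobActsAsNormAt` for an unramified rank-one `θ` through one Frobenius -/

section FrobNorm

variable {K : Type} [Field K] [NumberField K]

omit [NumberField K] in
/-- The characteristic polynomial of a `1 × 1` matrix: `charpoly (θ σ) = X − θ(σ)₀₀`. [folklore] -/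
theorem charpoly_eq_X_sub_C_entry (θ : FramedGaloisRep K (padicCoeffIntegers S) 1) (σ : absoluteGaloisGroup K) :
    FramedRep.charpoly θ σ = X - C (entry S θ σ) := by
  unfold FramedRep.charpoly Matrix.charpoly
  rw [Matrix.det_fin_one, Matrix.charmatrix_apply_eq]
  rfl

/-- **An unramified rank-one `θ` has Frobenius characteristic polynomial `X − θ(σ₀)` at `w`** for any one arithmetic
Frobenius `σ₀` above `w` (tree `GaloisRep.IsUnramifiedAt.hasFrobCharpolyAt_charpoly`: Frobenii above `w` form one
class modulo inertia and conjugation). [cite: SerreAbelianLadic1968, Ch. I §2.1] -/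
theorem hasFrobCharpolyAt_entry {θ : FramedGaloisRep K (padicCoeffIntegers S) 1} {w : HeightOneSpectrum (𝓞 K)}
    (hθ : θ.IsUnramifiedAt w) {𝔓 : Ideal (absIntegers (𝓞 K) K)} (h𝔓 : 𝔓 ∈ w.primesAbove)
    {σ₀ : absoluteGaloisGroup K} (hσ₀ : IsArithFrobAt (𝓞 K) σ₀ 𝔓) :
    θ.HasFrobCharpolyAt w (X - C (entry S θ σ₀)) := by
  have h1 : θ.toGaloisRep.IsUnramifiedAt w := (FramedGaloisRep.isUnramifiedAt_toGaloisRep_iff w θ).mpr hθ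
  have h2 := h1.hasFrobCharpolyAt_charpoly h𝔓 hσ₀
  have h3 := (FramedGaloisRep.hasFrobCharpolyAt_toGaloisRep_iff w _ θ).mp h2
  -- the polynomial is the framed one at `σ₀`
  have h4 : (θ.toGaloisRep σ₀).charpoly = X - C (entry S θ σ₀) := by
    rw [← charpoly_eq_X_sub_C_entry]; exact (h3 𝔓 h𝔓 σ₀ hσ₀).symm ▸ rfl
  rwa [h4] at h3

/-- **`FrobActsAsNormAt S θ w ↔ a ≡ Nw (mod p)`** for a rank-one `θ` unramified at `w`, an arithmetic Frobenius `σ₀` at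
`𝔓 ∣ w`, an integer `a` with `‖θ(σ₀) − a‖ < 1` and `Nw = ℓ`. [cite: KellerYin2024, Lemma 1.1.1 (arXiv:2402.12781v2 TeX L455–462)]
[cite: SerreAbelianLadic1968, Ch. I §2.1] -/
theorem frobActsAsNormAt_iff_intCast_eq {θ : FramedGaloisRep K (padicCoeffIntegers S) 1}
    {w : HeightOneSpectrum (𝓞 K)} (hθ : θ.IsUnramifiedAt w) {𝔓 : Ideal (absIntegers (𝓞 K) K)}
    (h𝔓 : 𝔓 ∈ w.primesAbove) {σ₀ : absoluteGaloisGroup K} (hσ₀ : IsArithFrobAt (𝓞 K) σ₀ 𝔓) {a : ℤ}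
    (ha : ‖((entry S θ σ₀ : padicCoeffIntegers S) : PadicAlgCl p) - (a : PadicAlgCl p)‖ < 1) {ℓ : ℕ}
    (hN : Ideal.absNorm w.asIdeal = ℓ) :
    FrobActsAsNormAt S θ w ↔ (a : ZMod p) = (ℓ : ZMod p) := by
  have hnorm : ‖(a : PadicAlgCl p) - (ℓ : PadicAlgCl p)‖ < 1 ↔ (a : ZMod p) = (ℓ : ZMod p) := by
    rw [show (a : PadicAlgCl p) - (ℓ : PadicAlgCl p) = (((a - ℓ : ℤ) : ℚ_[p]) : PadicAlgCl p) by push_cast; rfl,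
      PadicAlgCl.norm_extends, Padic.norm_intCast_lt_one_iff, ← ZMod.intCast_eq_intCast_iff_dvd_sub, Int.cast_natCast,
      eq_comm]
  constructor
  · rintro ⟨-, a', hP, hn⟩
    have hc := hP 𝔓 h𝔓 σ₀ hσ₀
    rw [charpoly_eq_X_sub_C_entry, sub_right_inj, C_inj] at hc
    rw [hN, ← hc] at hn
    rw [← hnorm]
    have e : (a : PadicAlgCl p) - (ℓ : PadicAlgCl p) =
        ((a : PadicAlgCl p) - ((entry S θ σ₀ : padicCoeffIntegers S) : PadicAlgCl p)) +
          (((entry S θ σ₀ : padicCoeffIntegers S) : PadicAlgCl p) - (ℓ : PadicAlgCl p)) := by ring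
    rw [e]
    refine (IsUltrametricDist.norm_add_le_max _ _).trans_lt (max_lt ?_ hn)
    rwa [norm_sub_rev]
  · intro hal
    refine ⟨hθ, entry S θ σ₀, hasFrobCharpolyAt_entry hθ h𝔓 hσ₀, ?_⟩
    rw [hN]
    have e : ((entry S θ σ₀ : padicCoeffIntegers S) : PadicAlgCl p) - (ℓ : PadicAlgCl p) =
        (((entry S θ σ₀ : padicCoeffIntegers S) : PadicAlgCl p) - (a : PadicAlgCl p)) +
          ((a : PadicAlgCl p) - (ℓ : PadicAlgCl p)) := by ring
    rw [e]
    exact (IsUltrametricDist.norm_add_le_max _ _).trans_lt (max_lt ha (hnorm.mpr hal))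

end FrobNorm

/-! ## §2 `λ(𝒫_w(f_E))` at a place of `K` above a multiplicative `ℓ` of `E/ℚ` -/

section Curve

variable {K : Type} [Field K] [NumberField K] (W : WeierstrassCurve ℚ) [W.IsElliptic]

/-- `N w = ℓ` for a place `w ∋ ℓ` of residue degree one over `ℚ`. [cite: NeukirchANT1999, Ch. I §8 (8.2)] -/
theorem absNorm_eq_of_inertiaDeg_eq_one {w : HeightOneSpectrum (𝓞 K)} {ℓ : ℕ} (hℓ : ℓ.Prime)
    (hw : ((ℓ : ℕ) : 𝓞 K) ∈ w.asIdeal) (hf : w.asIdeal.inertiaDeg (𝓞 ℚ) = 1) : Ideal.absNorm w.asIdeal = ℓ := by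
  have hℓv : ((ℓ : ℕ) : 𝓞 ℚ) ∈ (w.under (𝓞 ℚ)).asIdeal := by
    change ((ℓ : ℕ) : 𝓞 ℚ) ∈ w.asIdeal.comap (algebraMap (𝓞 ℚ) (𝓞 K))
    rw [Ideal.mem_comap, map_natCast]; exact hw
  have h := residueCard_eq_pow_inertiaDeg_of_under_eq (v := w.under (𝓞 ℚ)) (w := w) rfl
  rw [hf, pow_one, Rat.residueCard_eq_natGenerator,
    Rat.HeightOneSpectrum.natGenerator_eq_of_natCast_mem _ hℓ hℓv] at h
  exact h

/-- **`λ(𝒫_w(f_E)) = [Γ : Γ_w]·[ε ≡ ℓ (mod p)]`** for `E/ℚ` with `L_ℓ(E, T) = 1 − εT` (`ε = ±1`, multiplicative `ℓ`),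
`K` a number field, `w ∋ ℓ` of residue degree one, `p ≠ ℓ`: `L_w(E_K, T) = 1 − ε^{f}T = 1 − εT` (Silverman VII.5.4 (b), tree
`localPolynomialAt_baseChange_of_hasMultiplicativeReductionAt`), whose reduction has the simple root `ε⁻¹`, and
`curveLocalLambda` asks for the root `(Nw)⁻¹ = ℓ⁻¹`. [cite: KellerYin2024, §1.5 (arXiv:2402.12781v2 TeX L1337–1341)]
[cite: GreenbergVatsal2000, §2 Prop. (2.4) and p. 27] [cite: SilvermanAEC2009, VII.5 Prop. 5.4 (b) and §C.16] -/
theorem curveLocalLambda_baseChange_of_hasMultiplicativeReductionAt (κ : ZpExtension K p)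
    {w : HeightOneSpectrum (𝓞 K)} {ℓ : ℕ} (hℓ : ℓ.Prime) (hℓp : ℓ ≠ p) (hw : ((ℓ : ℕ) : 𝓞 K) ∈ w.asIdeal)
    (hf : w.asIdeal.inertiaDeg (𝓞 ℚ) = 1) (hmult : W.HasMultiplicativeReductionAt (w.under (𝓞 ℚ))) {ε : ℤ}
    (hε : ε = 1 ∨ ε = -1) (hL : W.localPolynomialAt (w.under (𝓞 ℚ)) = 1 - C ε * X) :
    curveLocalLambda κ (W.baseChange K) w = numPlacesAbove κ w * (if (ε : ZMod p) = (ℓ : ZMod p) then 1 else 0) := by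
  have hpp := hp.out
  rw [curveLocalLambda_eq]
  congr 1
  have hLw : (W.baseChange K).localPolynomialAt w = 1 - C ε * X := by
    rw [W.localPolynomialAt_baseChange_of_hasMultiplicativeReductionAt K (rfl : w.asIdeal.under (𝓞 ℚ) = _) hmult hL,
      hf, pow_one]
  have hℓ0 : (ℓ : ZMod p) ≠ 0 := by
    rw [Ne, ZMod.natCast_eq_zero_iff]
    exact fun h ↦ hℓp ((Nat.prime_dvd_prime_iff_eq hpp hℓ).mp h).symm
  have hε0 : (ε : ZMod p) ≠ 0 := by
    rcases hε with rfl | rfl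
    · simp
    · rw [Int.cast_neg, Int.cast_one, neg_ne_zero]; exact one_ne_zero
  unfold GreenbergVatsal2000.eulerFactorModP
  rw [hLw, absNorm_eq_of_inertiaDeg_eq_one hℓ hw hf, Polynomial.map_sub, Polynomial.map_one, Polynomial.map_mul,
    Polynomial.map_C, Polynomial.map_X, eq_intCast]
  have hfac : (1 - C (ε : ZMod p) * X : (ZMod p)[X]) = C (-(ε : ZMod p)) * (X - C ((ε : ZMod p)⁻¹)) := by
    rw [mul_sub, ← C_mul, neg_mul, mul_inv_cancel₀ hε0, map_neg, map_neg, map_one]; ring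
  have hne : (C (-(ε : ZMod p)) * (X - C ((ε : ZMod p)⁻¹)) : (ZMod p)[X]) ≠ 0 :=
    mul_ne_zero (by rw [Ne, C_eq_zero]; exact neg_ne_zero.mpr hε0) (X_sub_C_ne_zero _)
  rw [hfac, rootMultiplicity_mul hne, rootMultiplicity_C, zero_add, rootMultiplicity_X_sub_C]
  by_cases h : (ε : ZMod p) = (ℓ : ZMod p)
  · rw [if_pos h, if_pos (by rw [h])]
  · rw [if_neg h, if_neg (fun h' ↦ h (inv_injective h').symm)]

end Curve

/-! ## §3 The (eq:Euler-comp) summand at a multiplicative place, at the content stub's binders -/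

section Main

variable (W : WeierstrassCurve ℚ) [W.IsElliptic] [W.IsGloballyMinimal] (K : Type) [Field K] [NumberField K]

/-- **(eq:Euler-comp) at a multiplicative `ℓ ≠ p`, closed form.** For `W/ℚ` globally minimal, `2 < p`, `Red`, `Anom`,
(hlat), `K` imaginary quadratic with `p` split, ANY `ℤ_p`-extension `κ` of `K`, a residual pair `(θsub, θquot)` of
`E[p]` over `K`, a prime `ℓ ≠ p` of multiplicative reduction (non-split only for odd `ℓ`) and a place `w ∋ ℓ` of `K`
of residue degree one:
`charLocalLambda S κ θsub w + charLocalLambda S κ θquot w = curveLocalLambda κ (W⁄K) w + [split]·numPlacesAbove κ w`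
— the local terms `λ(𝒫_w(φ)) + λ(𝒫_w(ψ)) − λ(𝒫_w(E))` of (eq:Euler-comp) are `[Γ : Γ_w]` at a split `ℓ` and `0` at a
non-split one, whichever of `θsub, θquot` is the Tate line. [cite: CastellaGrossiLeeSkinner2022, Thm. 2.2.1 (a_ℓ ≡ φ(ℓ), ψ(ℓ) at ℓ ∥ N) and proof of Thm. 2.2.2 (eq:Euler-comp)]
[cite: GreenbergVatsal2000, §2 Prop. (2.4), pp. 14–15] [cite: KellerYin2024, Lemma 1.1.1 and §1.5 (arXiv:2402.12781v2 TeX L455–462, L1337–1341)] -/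
theorem eulerComp_summand_of_hasMultiplicativeReductionAtPrime (hp2 : 2 < p) (hred : Red W p)
    (hanom : Anom W p)
    (hlat : ∀ Φ : AddSubgroup (geomTorsion W (p : ℤ)), IsRationalLine W p Φ → ¬ LineUnramifiedAt W p Φ)
    (hK : IsImaginaryQuadratic K) (hHp : SatisfiesHeegnerHypothesis p K) (κ : ZpExtension K p)
    {θsub θquot : FramedGaloisRep K (padicCoeffIntegers S) 1} (h : IsResidualPairOver (W.baseChange K) p θsub θquot)
    {ℓ : ℕ} [hℓ : Fact ℓ.Prime] (hℓp : ℓ ≠ p) (hmult : W.HasMultiplicativeReductionAtPrime ℓ)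
    (hℓ2 : ¬ W.HasSplitMultiplicativeReductionAtPrime ℓ → ℓ ≠ 2)
    {w : HeightOneSpectrum (𝓞 K)} (hw : ((ℓ : ℕ) : 𝓞 K) ∈ w.asIdeal) (hf : w.asIdeal.inertiaDeg (𝓞 ℚ) = 1) :
    charLocalLambda S κ θsub w + charLocalLambda S κ θquot w =
      curveLocalLambda κ (W.baseChange K) w +
        (if W.HasSplitMultiplicativeReductionAtPrime ℓ then numPlacesAbove κ w else 0) := by
  have hpp := hp.out
  -- a Frobenius above `w`, unramifiedness, the scalars
  obtain ⟨𝔓, h𝔓⟩ := HeightOneSpectrum.primesAbove_nonempty w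
  obtain ⟨σ₀, hσ₀⟩ := HeightOneSpectrum.exists_isArithFrobAt_of_mem_primesAbove_holds h𝔓
  obtain ⟨hunr_sub, hunr_quot⟩ :=
    ResidualPairUnramifiedAtMultiplicative.isUnramifiedAt_baseChange_of_hasMultiplicativeReductionAtPrime W h hℓp hmult hw
  obtain ⟨a, b, ha, hb, hsplit, hns⟩ :=
    GoodLatticeResidualPairScalarsAtMultiplicative.residualPair_frob_scalars_of_hasMultiplicativeReductionAtPrime W K hp2
      hred hanom hlat hK hHp h hℓp hmult hw hf h𝔓 hσ₀
  have hN : Ideal.absNorm w.asIdeal = ℓ := absNorm_eq_of_inertiaDeg_eq_one hℓ.out hw hf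
  have hsubiff := frobActsAsNormAt_iff_intCast_eq hunr_sub h𝔓 hσ₀ ha hN
  have hquotiff := frobActsAsNormAt_iff_intCast_eq hunr_quot h𝔓 hσ₀ hb hN
  -- the place of `ℚ` below `w`
  have hℓv : ((ℓ : ℕ) : 𝓞 ℚ) ∈ (w.under (𝓞 ℚ)).asIdeal := by
    change ((ℓ : ℕ) : 𝓞 ℚ) ∈ w.asIdeal.comap (algebraMap (𝓞 ℚ) (𝓞 K))
    rw [Ideal.mem_comap, map_natCast]; exact hw
  have hmultv : W.HasMultiplicativeReductionAt (w.under (𝓞 ℚ)) :=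
    Summit.BirchSwinnertonDyer.Rank1Residual.X2.GreenbergVatsalStrictSelmerMultiplicative.hasMultiplicativeReductionAt_of_mem
      W ℓ hmult hℓv
  have hvℓ : ((Rat.HeightOneSpectrum.primesEquiv (w.under (𝓞 ℚ)) : Nat.Primes) : ℕ) = ℓ :=
    Rat.HeightOneSpectrum.primesEquiv_eq_of_natCast_mem _ hℓ.out hℓv
  have hℓ0 : (ℓ : ZMod p) ≠ 0 := by
    rw [Ne, ZMod.natCast_eq_zero_iff]
    exact fun h ↦ hℓp ((Nat.prime_dvd_prime_iff_eq hpp hℓ.out).mp h).symm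
  have h2ne : (2 : ZMod p) ≠ 0 := by
    intro h2
    have h2' : ((2 : ℕ) : ZMod p) = 0 := by exact_mod_cast h2
    rw [ZMod.natCast_eq_zero_iff] at h2'
    have := (Nat.prime_dvd_prime_iff_eq hpp Nat.prime_two).mp h2'
    omega
  have hnegℓ : ¬ (-(ℓ : ZMod p) = (ℓ : ZMod p)) := by
    intro hneg
    have h2ℓ : (2 : ZMod p) * (ℓ : ZMod p) = 0 := by
      rw [two_mul]; nth_rewrite 1 [← hneg]; rw [neg_add_cancel]
    rcases mul_eq_zero.mp h2ℓ with h | h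
    · exact h2ne h
    · exact hℓ0 h
  have hcs : charLocalLambda S κ θsub w = numPlacesAbove κ w * (if (a : ZMod p) = (ℓ : ZMod p) then 1 else 0) := by
    simp only [charLocalLambda, hsubiff]
  have hcq : charLocalLambda S κ θquot w = numPlacesAbove κ w * (if (b : ZMod p) = (ℓ : ZMod p) then 1 else 0) := by
    simp only [charLocalLambda, hquotiff]
  rw [hcs, hcq]
  by_cases hsp : W.HasSplitMultiplicativeReductionAtPrime ℓ
  · -- SPLIT: `L_ℓ(E) = 1 − T`
    have hsplitv : W.HasSplitMultiplicativeReductionAt (w.under (𝓞 ℚ)) := by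
      refine (WeierstrassCurve.hasSplitMultiplicativeReductionAtPrime_iff_hasSplitMultiplicativeReductionAt W
        (w.under (𝓞 ℚ))).mp ?_
      have key : ∀ (q : ℕ) (hq' : Fact q.Prime), q = ℓ →
          (haveI := hq'; W.HasSplitMultiplicativeReductionAtPrime q) := by
        rintro q hq' rfl; exact hsp
      exact key _ _ hvℓ
    have hL : W.localPolynomialAt (w.under (𝓞 ℚ)) = 1 - C (1 : ℤ) * X := by
      rw [localPolynomialAt_of_hasSplitMultiplicativeReductionAt hsplitv, map_one, one_mul]
    rw [if_pos hsp, curveLocalLambda_baseChange_of_hasMultiplicativeReductionAt W κ hℓ.out hℓp hw hf hmultv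
      (Or.inl rfl) hL, Int.cast_one]
    rcases hsplit hsp with ⟨h1, h2⟩ | ⟨h1, h2⟩
    · rw [h1, h2, if_pos rfl]
      split_ifs <;> ring
    · rw [h1, h2, if_pos rfl]
      split_ifs <;> ring
  · -- NON-SPLIT, `ℓ` odd: `L_ℓ(E) = 1 + T`
    have hnsv : ¬ W.HasSplitMultiplicativeReductionAt (w.under (𝓞 ℚ)) := by
      intro hsplitv
      apply hsp
      have h' := (WeierstrassCurve.hasSplitMultiplicativeReductionAtPrime_iff_hasSplitMultiplicativeReductionAt W
        (w.under (𝓞 ℚ))).mpr hsplitv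
      have key : ∀ (q : ℕ) (hq' : Fact q.Prime), q = ℓ →
          (haveI := hq'; W.HasSplitMultiplicativeReductionAtPrime q) → W.HasSplitMultiplicativeReductionAtPrime ℓ := by
        rintro q hq' rfl h''; exact h''
      exact key _ _ hvℓ h'
    have hL : W.localPolynomialAt (w.under (𝓞 ℚ)) = 1 - C (-1 : ℤ) * X := by
      rw [localPolynomialAt_of_hasMultiplicativeReductionAt_of_not_hasSplitMultiplicativeReductionAt hmultv hnsv,
        map_neg, map_one]; ring
    rw [if_neg hsp, curveLocalLambda_baseChange_of_hasMultiplicativeReductionAt W κ hℓ.out hℓp hw hf hmultv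
      (Or.inr rfl) hL, Int.cast_neg, Int.cast_one]
    rcases hns hsp (hℓ2 hsp) with ⟨h1, h2⟩ | ⟨h1, h2⟩
    · rw [h1, h2, if_neg hnegℓ]
      split_ifs <;> ring
    · rw [h1, h2, if_neg hnegℓ]
      split_ifs <;> ring

/-- **The same with `f(w|ℓ) = 1` supplied by the Heegner hypothesis for the conductor** (`ℓ ∣ N_E` splits in `K`):
the form read by the content stub 3a-A, whose `Sf` is `{w : N_E ∈ w}` under `SatisfiesHeegnerHypothesis (W.conductorNorm ℤ) K`
(tree `UnrSelmerQuotientTorsionFiniteChar.ramificationIdx_inertiaDeg_eq_one_of_heegner`).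
[cite: CastellaGrossiLeeSkinner2022, proof of Thm. 2.2.2 (eq:Euler-comp)] [cite: GreenbergVatsal2000, §2 Prop. (2.4)] -/
theorem eulerComp_summand_of_hasMultiplicativeReductionAtPrime_of_heegner (hp2 : 2 < p) (hred : Red W p)
    (hanom : Anom W p)
    (hlat : ∀ Φ : AddSubgroup (geomTorsion W (p : ℤ)), IsRationalLine W p Φ → ¬ LineUnramifiedAt W p Φ)
    (hK : IsImaginaryQuadratic K) (hHp : SatisfiesHeegnerHypothesis p K) {N : ℕ} (hHN : SatisfiesHeegnerHypothesis N K)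
    (κ : ZpExtension K p)
    {θsub θquot : FramedGaloisRep K (padicCoeffIntegers S) 1} (h : IsResidualPairOver (W.baseChange K) p θsub θquot)
    {ℓ : ℕ} [hℓ : Fact ℓ.Prime] (hℓp : ℓ ≠ p) (hmult : W.HasMultiplicativeReductionAtPrime ℓ)
    (hℓ2 : ¬ W.HasSplitMultiplicativeReductionAtPrime ℓ → ℓ ≠ 2)
    {w : HeightOneSpectrum (𝓞 K)} (hw : ((ℓ : ℕ) : 𝓞 K) ∈ w.asIdeal) (hNw : ((N : ℤ) : 𝓞 K) ∈ w.asIdeal) :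
    charLocalLambda S κ θsub w + charLocalLambda S κ θquot w =
      curveLocalLambda κ (W.baseChange K) w +
        (if W.HasSplitMultiplicativeReductionAtPrime ℓ then numPlacesAbove κ w else 0) :=
  eulerComp_summand_of_hasMultiplicativeReductionAtPrime W K hp2 hred hanom hlat hK hHp κ h hℓp hmult hℓ2 hw
    (UnrSelmerQuotientTorsionFiniteChar.ramificationIdx_inertiaDeg_eq_one_of_heegner hK hHN w hNw).2

end Main

end Summit.BirchSwinnertonDyer.BirchSwinnertonDyer.Theorems.GoodLatticeAnacongEulerCompMultiplicative

end
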